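import Summits.CriticalPhenomena.Ising3D.Control2DBoxCells
import Summits.CriticalPhenomena.Ising3D.Control2DL11BoxAData1
import Summits.CriticalPhenomena.Ising3D.Control2DL11BoxAData2
import Summits.CriticalPhenomena.Ising3D.Control2DL11BoxAData3
import Summits.CriticalPhenomena.Ising3D.Control2DL11BoxAData4
import Summits.CriticalPhenomena.Ising3D.Control2DL11BoxAData5
import Summits.CriticalPhenomena.Ising3D.Control2DL11BoxAData6
import Summits.CriticalPhenomena.Ising3D.Control2DL11BoxAData7
import Mathlib.Tactic.IntervalCases
import Mathlib.Tactic.Linarith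
import Mathlib.Tactic.NormNum
import HarnessLib

/-!
# Kernel replay of the RB-2 certificate `j110367_functional_deriv2d_L11_E032_sig1o8_box0-0.16.json` (Λ = 11, E₀ = 32): Δ_ε ∉ [0, 4/25] at Δ_σ = 1/8 under A2D′: the cells as ONE theorem
(cell `pub-ising3x`, seat controls-1 gen 16; KERNEL PATH for the 2D γ-certificates, Λ = 11 — CONTROL-ONLY)

HONEST FRAMING: lottery ticket; floor = tightest certified 3D Ising CFT bounds; no exact-solution
claim without a proof. CONTROL-ONLY (`d = 2`, `Δ_σ = 1/8`; axiom set A2D′).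

`cells_boxA`: every cell obligation of the certificate ((E) on the ε box, (C′) scalars on [2, 32), the stress-tensor point (T), spin 2 on [3, 32), even spins 4…30 on [ℓ, 32)), in the witness form `∃ N ≥ E₀` with the spin's own truncation
order, from the kernel-decided Bernstein leaves of `Control2DL11BoxAData*` via `cell_nonneg_of_bernCheck`. No facts, standard axioms only.
-/

namespace Summit.CriticalPhenomena.Ising3D.Control2D

open Finset Set
open Literature.MathematicalPhysics.QuantumFieldTheory.ConformalBootstrap3D

set_option maxHeartbeats 0 in
/-- **The cells of the certificate** (Δ_ε ∉ [0, 4/25] at Δ_σ = 1/8 under A2D′; `E₀ = 32`; truncation `N = Nd + 1` per spin: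
all `N = 32`). [folklore] -/
theorem cells_boxA :
    BoxCellsN slL11.toFinset (fun p => (wtboxA p : ℝ)) (1 / 8) 2 1 (0) (4 / 25) 32 := by
  refine ⟨?_, ?_, ?_, ?_, ?_⟩
  · intro Δ h1 h2
    refine ⟨32, by norm_num, ?_⟩
    exact cell_nonneg_of_bernCheck wtboxA slL11_nodup slL11_deg 0 31 (q := 25) (a := 0)
        (L := 2) (by norm_num) (by norm_num) (by norm_num) (by rw [phatboxAs0_eq]; exact cellChk_boxA_s0l0)
        (by norm_num; linarith) (by norm_num; linarith)
  · intro Δ h1 h2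
    replace h2 := h2.le
    refine ⟨32, by norm_num, ?_⟩
    exact cell_nonneg_of_bernCheck wtboxA slL11_nodup slL11_deg 0 31 (q := 1) (a := 1)
        (L := 15) (by norm_num) (by norm_num) (by norm_num) (by rw [phatboxAs0_eq]; exact cellChk_boxA_s0l1)
        (by norm_num; linarith) (by norm_num; linarith)
  · refine ⟨32, by norm_num, ?_⟩
    exact cell_nonneg_of_bernCheck wtboxA slL11_nodup slL11_deg 2 31 (q := 1) (a := 0)
        (L := 0) (by norm_num) (by norm_num) (by norm_num) (by rw [phatboxAs2_eq]; exact cellChk_boxA_s2l0)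
        (by norm_num) (by norm_num)
  · intro Δ h1 h2
    replace h1 : (3 : ℝ) ≤ Δ := by linarith
    replace h2 := h2.le
    refine ⟨32, by norm_num, ?_⟩
    exact cell_nonneg_of_bernCheck wtboxA slL11_nodup slL11_deg 2 31 (q := 2) (a := 1)
        (L := 29) (by norm_num) (by norm_num) (by norm_num) (by rw [phatboxAs2_eq]; exact cellChk_boxA_s2l1)
        (by norm_num; linarith) (by norm_num; linarith)
  · intro ℓ hℓ hℓ0 hℓ2 Δ hℓΔ hΔ
    have hℓR : (ℓ : ℝ) < 32 := lt_of_le_of_lt hℓΔ hΔ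
    have hℓ32 : ℓ < 32 := by exact_mod_cast hℓR
    replace h2 := hΔ.le
    interval_cases ℓ
    · exact absurd rfl hℓ0
    · exact absurd hℓ (by decide)
    · exact absurd rfl hℓ2
    · exact absurd hℓ (by decide)
    · have h1 : (4 : ℝ) ≤ Δ := by exact_mod_cast hℓΔ
      refine ⟨32, by norm_num, ?_⟩
      exact cell_nonneg_of_bernCheck wtboxA slL11_nodup slL11_deg 4 31 (q := 1) (a := 0)
          (L := 14) (by norm_num) (by norm_num) (by norm_num) (by rw [phatboxAs4_eq]; exact cellChk_boxA_s4l0)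
          (by norm_num; linarith) (by norm_num; linarith)
    · exact absurd hℓ (by decide)
    · have h1 : (6 : ℝ) ≤ Δ := by exact_mod_cast hℓΔ
      refine ⟨32, by norm_num, ?_⟩
      exact cell_nonneg_of_bernCheck wtboxA slL11_nodup slL11_deg 6 31 (q := 1) (a := 0)
          (L := 13) (by norm_num) (by norm_num) (by norm_num) (by rw [phatboxAs6_eq]; exact cellChk_boxA_s6l0)
          (by norm_num; linarith) (by norm_num; linarith)
    · exact absurd hℓ (by decide)
    · have h1 : (8 : ℝ) ≤ Δ := by exact_mod_cast hℓΔ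
      refine ⟨32, by norm_num, ?_⟩
      exact cell_nonneg_of_bernCheck wtboxA slL11_nodup slL11_deg 8 31 (q := 1) (a := 0)
          (L := 12) (by norm_num) (by norm_num) (by norm_num) (by rw [phatboxAs8_eq]; exact cellChk_boxA_s8l0)
          (by norm_num; linarith) (by norm_num; linarith)
    · exact absurd hℓ (by decide)
    · have h1 : (10 : ℝ) ≤ Δ := by exact_mod_cast hℓΔ
      refine ⟨32, by norm_num, ?_⟩
      exact cell_nonneg_of_bernCheck wtboxA slL11_nodup slL11_deg 10 31 (q := 1) (a := 0)
          (L := 11) (by norm_num) (by norm_num) (by norm_num) (by rw [phatboxAs10_eq]; exact cellChk_boxA_s10l0)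
          (by norm_num; linarith) (by norm_num; linarith)
    · exact absurd hℓ (by decide)
    · have h1 : (12 : ℝ) ≤ Δ := by exact_mod_cast hℓΔ
      refine ⟨32, by norm_num, ?_⟩
      exact cell_nonneg_of_bernCheck wtboxA slL11_nodup slL11_deg 12 31 (q := 1) (a := 0)
          (L := 10) (by norm_num) (by norm_num) (by norm_num) (by rw [phatboxAs12_eq]; exact cellChk_boxA_s12l0)
          (by norm_num; linarith) (by norm_num; linarith)
    · exact absurd hℓ (by decide)
    · have h1 : (14 : ℝ) ≤ Δ := by exact_mod_cast hℓΔ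
      refine ⟨32, by norm_num, ?_⟩
      exact cell_nonneg_of_bernCheck wtboxA slL11_nodup slL11_deg 14 31 (q := 1) (a := 0)
          (L := 9) (by norm_num) (by norm_num) (by norm_num) (by rw [phatboxAs14_eq]; exact cellChk_boxA_s14l0)
          (by norm_num; linarith) (by norm_num; linarith)
    · exact absurd hℓ (by decide)
    · have h1 : (16 : ℝ) ≤ Δ := by exact_mod_cast hℓΔ
      refine ⟨32, by norm_num, ?_⟩
      exact cell_nonneg_of_bernCheck wtboxA slL11_nodup slL11_deg 16 31 (q := 1) (a := 0)
          (L := 8) (by norm_num) (by norm_num) (by norm_num) (by rw [phatboxAs16_eq]; exact cellChk_boxA_s16l0)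
          (by norm_num; linarith) (by norm_num; linarith)
    · exact absurd hℓ (by decide)
    · have h1 : (18 : ℝ) ≤ Δ := by exact_mod_cast hℓΔ
      refine ⟨32, by norm_num, ?_⟩
      exact cell_nonneg_of_bernCheck wtboxA slL11_nodup slL11_deg 18 31 (q := 1) (a := 0)
          (L := 7) (by norm_num) (by norm_num) (by norm_num) (by rw [phatboxAs18_eq]; exact cellChk_boxA_s18l0)
          (by norm_num; linarith) (by norm_num; linarith)
    · exact absurd hℓ (by decide)
    · have h1 : (20 : ℝ) ≤ Δ := by exact_mod_cast hℓΔ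
      refine ⟨32, by norm_num, ?_⟩
      exact cell_nonneg_of_bernCheck wtboxA slL11_nodup slL11_deg 20 31 (q := 1) (a := 0)
          (L := 6) (by norm_num) (by norm_num) (by norm_num) (by rw [phatboxAs20_eq]; exact cellChk_boxA_s20l0)
          (by norm_num; linarith) (by norm_num; linarith)
    · exact absurd hℓ (by decide)
    · have h1 : (22 : ℝ) ≤ Δ := by exact_mod_cast hℓΔ
      refine ⟨32, by norm_num, ?_⟩
      exact cell_nonneg_of_bernCheck wtboxA slL11_nodup slL11_deg 22 31 (q := 1) (a := 0)
          (L := 5) (by norm_num) (by norm_num) (by norm_num) (by rw [phatboxAs22_eq]; exact cellChk_boxA_s22l0)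
          (by norm_num; linarith) (by norm_num; linarith)
    · exact absurd hℓ (by decide)
    · have h1 : (24 : ℝ) ≤ Δ := by exact_mod_cast hℓΔ
      refine ⟨32, by norm_num, ?_⟩
      exact cell_nonneg_of_bernCheck wtboxA slL11_nodup slL11_deg 24 31 (q := 1) (a := 0)
          (L := 4) (by norm_num) (by norm_num) (by norm_num) (by rw [phatboxAs24_eq]; exact cellChk_boxA_s24l0)
          (by norm_num; linarith) (by norm_num; linarith)
    · exact absurd hℓ (by decide)
    · have h1 : (26 : ℝ) ≤ Δ := by exact_mod_cast hℓΔ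
      refine ⟨32, by norm_num, ?_⟩
      exact cell_nonneg_of_bernCheck wtboxA slL11_nodup slL11_deg 26 31 (q := 1) (a := 0)
          (L := 3) (by norm_num) (by norm_num) (by norm_num) (by rw [phatboxAs26_eq]; exact cellChk_boxA_s26l0)
          (by norm_num; linarith) (by norm_num; linarith)
    · exact absurd hℓ (by decide)
    · have h1 : (28 : ℝ) ≤ Δ := by exact_mod_cast hℓΔ
      refine ⟨32, by norm_num, ?_⟩
      exact cell_nonneg_of_bernCheck wtboxA slL11_nodup slL11_deg 28 31 (q := 1) (a := 0)
          (L := 2) (by norm_num) (by norm_num) (by norm_num) (by rw [phatboxAs28_eq]; exact cellChk_boxA_s28l0)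
          (by norm_num; linarith) (by norm_num; linarith)
    · exact absurd hℓ (by decide)
    · have h1 : (30 : ℝ) ≤ Δ := by exact_mod_cast hℓΔ
      refine ⟨32, by norm_num, ?_⟩
      exact cell_nonneg_of_bernCheck wtboxA slL11_nodup slL11_deg 30 31 (q := 1) (a := 0)
          (L := 1) (by norm_num) (by norm_num) (by norm_num) (by rw [phatboxAs30_eq]; exact cellChk_boxA_s30l0)
          (by norm_num; linarith) (by norm_num; linarith)
    · exact absurd hℓ (by decide)

end Summit.CriticalPhenomena.Ising3D.Control2D
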